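import Summits.QuantumFields.YangMills.Theorems.BalabanUVNodesN08HaarCompatibilityForestsSpectator
import Summits.QuantumFields.YangMills.Theorems.BalabanUVNodesN08HaarCompatibilityOneBond

/-!
# BalabanUVNodes ∕ N08 — E6′ ON THE σ-ALGEBRA OF ONE COARSE PLAQUETTE IS A ONE-DIMENSIONAL QUESTION: the law of a plaquette holonomy under `dV` is Haar, so under print's
# image law `Ū_*(dU)` (coarse-gauge invariant) the four variables of a plaquette are distributed as under `dV` IFF the law `κ_p` of the holonomy `Ū(U)(∂p)` is Haar; any single
# statistic `∫ f(Ū(U)(∂p)) dU ≠ ∫ f dHaar` refutes E6′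

WIDTH SEAT `pub-ymgap-dag-n08-w3` g7, item-3 lineage PART 44 (successor of part 42 `…ForestsSpectator` §4 (three bonds of a plaquette are `Haar³` independent of the holonomy) and of
g0's `…HaarCompatibilityOneBond` ∕ `…Forests` (E6′ holds on one-bond and forest σ-algebras)), 2026-08-28.  Track A, DAG node N08 = [Balaban1985UV3] Thm 1 p. 257 (compact) + Thm 2
p. 272; key item K1⁷ `StabilityBAtRecordR13SepCoPH` (stmt-QuantumFields-20542), `--supports … --as helper`.  COUNT-NEUTRAL.

THE POINT (for the E6′ desk; located, count-neutral).  E6′ = «`(avOfPrint N S₀ j)_*(dU) = dV`» is NOT in print and undecided at `N ≥ 2`.  g0 showed it holds on every forest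
σ-algebra; part 42 showed that under ANY finite gauge-invariant coarse law the three tree bonds of a plaquette `p` are `Haar³` independent of `V(∂p)`.  Hence (§3
`map_plaquette_eq_iff_map_plaqHol_eq_haar`): **E6′ restricted to the four variables of one coarse plaquette `p` ⟺ `κ_p := law_{dU}(Ū(U)(∂p)) = Haar`** (below the top level) — a
question about ONE probability measure on `SU(N)` (a class-function expansion, since `κ_p` is conjugation invariant).  In particular (§2 `map_avOfPrint_ne_of_integral_plaqHol_ne`):
**one number refutes E6′** — any bounded measurable `f` with `∫ f(Ū(U)(∂p)) dU ≠ ∫ f dHaar`.  (Remark, not typed: the first moment `f = Re Tr` vanishes on both sides by centre symmetry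
— flip the sign of the fine bonds crossing one block interface; the first informative statistic is `f = |Tr|²`, Haar value `1`.)

* §1 `plaqHol_update_last` ∕ `map_plaqHol_fieldMeasure_eq_haar` — **the law of a plaquette holonomy under product Haar is Haar** (right translations of `V(x,ν)`; Weil uniqueness).
* §2 `map_plaqHol_eq_haar_of_map_eq` (any measurable map `Φ` with `Φ_*(dU) = dV` has Haar plaquette holonomies), `integral_comp_plaqHol_eq_of_map_eq`, and at the slot
  ★★ `map_avOfPrint_ne_of_integral_plaqHol_ne` (the one-number refutation shape).
* §3 ★★★ `map_plaquette_eq_iff_map_plaqHol_eq_haar` (E6′ on σ(p) ⟺ `κ_p = Haar`; part 42 §4 on both laws + the reconstruction `V(x,ν) = V(∂p)⁻¹·V(x,μ)V(x+e_μ,ν)V(x+e_ν,μ)⁻¹`).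

HONEST FRAMING.  [folklore] measure theory over landed modules; nothing of Bałaban's asserted; E6′ NEITHER proved NOR refuted here (a reduction and a test shape only); no bound,
NO (G3), NO k-uniform `hmass`; N08 NOT discharged; counts unmoved (typed 28∕28 · discharged 5∕27); one finite 𝕋⁴ programme at fixed ε — R4 closes the CONDITIONAL rung
`BalabanLadder.UV` only; the Yang–Mills mass gap (Clay) is NOT proved by any of this; nothing continuum ∕ ℝ⁴ ∕ OS.  0 `sorry`, 0 `def`, 0 `instance`, standard axioms.
-/

noncomputable section

open MeasureTheory
open scoped ENNReal

namespace Summit.QuantumFields.YangMills.BalabanUVNodes.N08HaarCompatibilityPlaquetteTest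

open Literature.MathematicalPhysics.QuantumFieldTheory.Balaban1983to89
open Literature.MathematicalPhysics.QuantumFieldTheory.Balaban1983to89.B12SmallFieldDomain259 (src_ne_tgt)
open Summit.QuantumFields.YangMills.BalabanUVNodes.N08HaarCompatibilityForests (eq_mass_smul_haar_of_map_mul_right)
open Summit.QuantumFields.YangMills.BalabanUVNodes.N08HaarCompatibilityPrivateSources (map_gaugeAct_fieldMeasure)
open Summit.QuantumFields.YangMills.BalabanUVNodes.N08HaarCompatibilityGuardHybridCovariance (shift_injective_dir)
open Summit.QuantumFields.YangMills.BalabanUVNodes.N08HaarCompatibilityForestsSpectator (map_plaquetteTree_prod_plaqHol)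

/-! ## §1 The law of a plaquette holonomy under product Haar -/

section Haar

variable {P : Params} {k : ℕ} {G : Type*} [GaugeGroup G] [MeasurableSpace G] [HaarData G] [MeasurableMul₂ G] [MeasurableInv G]

omit [MeasurableSpace G] [HaarData G] [MeasurableMul₂ G] [MeasurableInv G] in
/-- Left-translating the last bond variable `V(x,ν)` of a plaquette right-translates its holonomy: `V(∂p) ↦ V(∂p)·g⁻¹`. [cite: Balaban1985Averaging, (9) p.19 (bookkeeping)] -/
theorem plaqHol_update_last (p : Plaq P k) (g : G) (V : GaugeField P k G) :
    GaugeField.plaqHol (fun b => if b = (⟨p.src, p.ν⟩ : PBond P k) then g * V b else V b) p = GaugeField.plaqHol V p * g⁻¹ := by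
  have hμν : p.μ ≠ p.ν := ne_of_lt p.hμν
  have h1 : (⟨p.src, p.μ⟩ : PBond P k) ≠ ⟨p.src, p.ν⟩ := fun e => hμν (congrArg PBond.dir e)
  have h2 : (⟨p.src.shift p.μ, p.ν⟩ : PBond P k) ≠ ⟨p.src, p.ν⟩ := fun e => src_ne_tgt (⟨p.src, p.μ⟩ : PBond P k) (congrArg PBond.src e).symm
  have h3 : (⟨p.src.shift p.ν, p.μ⟩ : PBond P k) ≠ ⟨p.src, p.ν⟩ := fun e => hμν (congrArg PBond.dir e)
  simp only [GaugeField.plaqHol, if_neg h1, if_neg h2, if_neg h3, if_true, mul_inv_rev, mul_assoc]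

omit [HaarData G] in
/-- The holonomy map is measurable. [folklore] -/
theorem measurable_plaqHol (p : Plaq P k) : Measurable fun V : GaugeField P k G => GaugeField.plaqHol V p := by
  have hev : ∀ c : PBond P k, Measurable fun V : GaugeField P k G => V c := fun c => measurable_pi_apply c
  unfold GaugeField.plaqHol
  exact (((hev _).mul (hev _)).mul (hev _).inv).mul (hev _).inv

/-- ★★ **THE LAW OF A PLAQUETTE HOLONOMY UNDER PRODUCT HAAR IS HAAR**: `dV∘(V ↦ V(∂p))⁻¹ = Haar` — left translations of the coordinate `V(x,ν)` preserve `dV` and right-translate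
`V(∂p)`, so the law is right invariant; Weil uniqueness. [cite: Balaban1985Averaging, (9)–(10) p.19 (bookkeeping); folklore] -/
theorem map_plaqHol_fieldMeasure_eq_haar (p : Plaq P k) : (fieldMeasure P k G).map (fun V : GaugeField P k G => GaugeField.plaqHol V p) = (HaarData.haar : Measure G) := by
  haveI := HaarData.isProb (G := G)
  set κ := (fieldMeasure P k G).map (fun V : GaugeField P k G => GaugeField.plaqHol V p) with hκ
  haveI : IsProbabilityMeasure κ := Measure.isProbabilityMeasure_map (measurable_plaqHol p).aemeasurable
  have hinv : ∀ g : G, κ.map (fun x => x * g) = κ := by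
    intro g
    -- the coordinate translation `T`
    have hT : MeasurePreserving (fun (V : GaugeField P k G) (b : PBond P k) => if b = (⟨p.src, p.ν⟩ : PBond P k) then g⁻¹ * V b else V b)
        (fieldMeasure P k G) (fieldMeasure P k G) := by
      unfold fieldMeasure
      refine measurePreserving_pi (fun _ : PBond P k => (HaarData.haar : Measure G)) (fun _ => HaarData.haar)
        (f := fun b (h : G) => if b = (⟨p.src, p.ν⟩ : PBond P k) then g⁻¹ * h else h) fun b => ?_
      show MeasurePreserving (fun h : G => if b = (⟨p.src, p.ν⟩ : PBond P k) then g⁻¹ * h else h) HaarData.haar HaarData.haar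
      by_cases hb : b = (⟨p.src, p.ν⟩ : PBond P k)
      · simp only [hb, if_true]; exact ⟨measurable_const_mul _, HaarData.map_mul_left _⟩
      · simp only [hb, if_false]; exact MeasurePreserving.id _
    have hcomp : (fun x : G => x * g) ∘ (fun V : GaugeField P k G => GaugeField.plaqHol V p) =
        (fun V : GaugeField P k G => GaugeField.plaqHol V p) ∘ (fun (V : GaugeField P k G) (b : PBond P k) => if b = (⟨p.src, p.ν⟩ : PBond P k) then g⁻¹ * V b else V b) := by
      funext V
      simp only [Function.comp]
      rw [plaqHol_update_last, inv_inv]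
    rw [hκ, Measure.map_map (measurable_mul_const g) (measurable_plaqHol p), hcomp, ← Measure.map_map (measurable_plaqHol p) hT.measurable]
    exact congrArg (Measure.map fun V : GaugeField P k G => GaugeField.plaqHol V p) hT.map_eq
  rw [eq_mass_smul_haar_of_map_mul_right κ hinv, measure_univ, one_smul]

/-! ## §2 Haar-compatible maps have Haar plaquette holonomies; the one-number refutation shape -/

variable {j : ℕ}

/-- **A HAAR-COMPATIBLE MAP HAS HAAR PLAQUETTE HOLONOMIES**: if `Φ_*(dU) = dV` then `law_{dU}(Φ(U)(∂p)) = Haar` for every coarse plaquette `p`. [cite: Balaban1985Averaging, (10) p.19; Balaban1987RG1, (2.1) p.265 (bookkeeping; E6′ NOT IN PRINT)] -/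
theorem map_plaqHol_eq_haar_of_map_eq {Φ : GaugeField P j G → GaugeField P k G} (hΦ : Measurable Φ) (h : (fieldMeasure P j G).map Φ = fieldMeasure P k G) (p : Plaq P k) :
    (fieldMeasure P j G).map (fun U => GaugeField.plaqHol (Φ U) p) = (HaarData.haar : Measure G) := by
  rw [← map_plaqHol_fieldMeasure_eq_haar (P := P) (k := k) p, ← h, Measure.map_map (measurable_plaqHol p) hΦ]
  rfl

/-- … in integral form: `∫ f(Φ(U)(∂p)) dU = ∫ f dHaar` for every measurable `f`. [cite: Balaban1985Averaging, (10) p.19 (bookkeeping; E6′ NOT IN PRINT)] -/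
theorem integral_comp_plaqHol_eq_of_map_eq {Φ : GaugeField P j G → GaugeField P k G} (hΦ : Measurable Φ) (h : (fieldMeasure P j G).map Φ = fieldMeasure P k G) (p : Plaq P k)
    (f : G → ℝ) (hf : Measurable f) :
    ∫ U, f (GaugeField.plaqHol (Φ U) p) ∂(fieldMeasure P j G) = ∫ x, f x ∂(HaarData.haar : Measure G) := by
  have hm : Measurable fun U : GaugeField P j G => GaugeField.plaqHol (Φ U) p := (measurable_plaqHol p).comp hΦ
  rw [← map_plaqHol_eq_haar_of_map_eq hΦ h p, integral_map hm.aemeasurable hf.aestronglyMeasurable]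

end Haar

section Slot

open Literature.MathematicalPhysics.QuantumFieldTheory.Balaban1985CMP102.Setting (Scales)
open Literature.MathematicalPhysics.QuantumFieldTheory.Balaban1983to89.B10RunsOfRecord (avOfPrint)
open Literature.MathematicalPhysics.QuantumFieldTheory.Balaban1983to89.Node00 (SU)
open Literature.MathematicalPhysics.QuantumFieldTheory.Balaban1983to89.B10Eq2HaarCompatibility (measurable_avOfPrint)
open Summit.QuantumFields.YangMills.BalabanUVNodes.N08HaarCompatibilityOneBond (map_gaugeAct_imageLaw_avOfPrint)

variable (N : ℕ) [NeZero N] {L : ℕ}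

/-- ★★ **ONE NUMBER REFUTES E6′**: at print's averaging `avOfPrint N S₀ j` on `SU(N)` (every `N`, every level), any coarse plaquette `p` and measurable `f : SU(N) → ℝ` with
`∫ f(Ū(U)(∂p)) dU ≠ ∫ f dHaar` give `Ū_*(dU) ≠ dV`. [cite: Balaban1985Averaging, (10) p.19; Balaban1987RG1, (2.1) p.265 (bookkeeping; E6′ NOT IN PRINT)] -/
theorem map_avOfPrint_ne_of_integral_plaqHol_ne (S₀ : Scales L) (j : ℕ) (p : Plaq S₀.P (j + 1)) (f : SU N → ℝ) (hf : Measurable f)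
    (hne : ∫ U, f (GaugeField.plaqHol ((avOfPrint N S₀ j).avg U) p) ∂(fieldMeasure S₀.P j (SU N)) ≠ ∫ x, f x ∂(HaarData.haar : Measure (SU N))) :
    (fieldMeasure S₀.P j (SU N)).map (avOfPrint N S₀ j).avg ≠ fieldMeasure S₀.P (j + 1) (SU N) :=
  fun h => hne (integral_comp_plaqHol_eq_of_map_eq (measurable_avOfPrint N S₀ j) h p f hf)

/-! ## §3 E6′ on the σ-algebra of one plaquette ⟺ the holonomy law is Haar -/

/-- The reconstruction `(tree, holonomy) ↦ four bond variables`: `V(x,ν) = V(∂p)⁻¹·V(x,μ)·V(x+e_μ,ν)·V(x+e_ν,μ)⁻¹` (plumbing). [cite: Balaban1985Averaging, (9) p.19 (bookkeeping)] -/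
theorem quad_eq_comp_treeHol {P : Params} {k : ℕ} {G : Type*} [GaugeGroup G] (p : Plaq P k) (V : GaugeField P k G) :
    (fun m : Fin 4 => V ((![⟨p.src, p.μ⟩, ⟨p.src.shift p.μ, p.ν⟩, ⟨p.src.shift p.ν, p.μ⟩, ⟨p.src, p.ν⟩] : Fin 4 → PBond P k) m)) =
      (fun q : (Fin 3 → G) × G => (![q.1 0, q.1 1, q.1 2, q.2⁻¹ * q.1 0 * q.1 1 * (q.1 2)⁻¹] : Fin 4 → G))
        ((fun m : Fin 3 => V ((![⟨p.src, p.μ⟩, ⟨p.src.shift p.μ, p.ν⟩, ⟨p.src.shift p.ν, p.μ⟩] : Fin 3 → PBond P k) m)), GaugeField.plaqHol V p) := by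
  funext m
  fin_cases m
  · rfl
  · rfl
  · rfl
  · show V ⟨p.src, p.ν⟩ = (GaugeField.plaqHol V p)⁻¹ * V ⟨p.src, p.μ⟩ * V ⟨p.src.shift p.μ, p.ν⟩ * (V ⟨p.src.shift p.ν, p.μ⟩)⁻¹
    simp only [GaugeField.plaqHol, mul_inv_rev, inv_inv]
    group

/-- ★★★ **E6′ ON THE σ-ALGEBRA OF ONE COARSE PLAQUETTE ⟺ THE HOLONOMY LAW IS HAAR.**  Below the top level, for print's averaging `Ū = avOfPrint N S₀ j` on `SU(N)` (every `N`) and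
every coarse plaquette `p`: the joint law under `Ū_*(dU)` of the four bond variables of `p` equals their law under `dV` IFF `κ_p := law_{dU}(Ū(U)(∂p))` is Haar — both laws are
coarse-gauge invariant, so part 42 §4 puts both in the form `Haar³ ⊗ (holonomy law)` in the coordinates (tree, holonomy), and under `dV` the holonomy law is Haar (§1).
[cite: Balaban1985Averaging, (9)–(10) p.19; Balaban1987RG1, (2.1) p.265 (bookkeeping; E6′ NOT IN PRINT — neither proved nor refuted here)] -/
theorem map_plaquette_eq_iff_map_plaqHol_eq_haar (S₀ : Scales L) {j : ℕ} (h : j + 1 < S₀.P.m + S₀.P.K) (p : Plaq S₀.P (j + 1)) :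
    ((fieldMeasure S₀.P j (SU N)).map (avOfPrint N S₀ j).avg).map
        (fun (V : GaugeField S₀.P (j + 1) (SU N)) (m : Fin 4) => V ((![⟨p.src, p.μ⟩, ⟨p.src.shift p.μ, p.ν⟩, ⟨p.src.shift p.ν, p.μ⟩, ⟨p.src, p.ν⟩] : Fin 4 → PBond S₀.P (j + 1)) m)) =
      (fieldMeasure S₀.P (j + 1) (SU N)).map
        (fun (V : GaugeField S₀.P (j + 1) (SU N)) (m : Fin 4) => V ((![⟨p.src, p.μ⟩, ⟨p.src.shift p.μ, p.ν⟩, ⟨p.src.shift p.ν, p.μ⟩, ⟨p.src, p.ν⟩] : Fin 4 → PBond S₀.P (j + 1)) m)) ↔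
    ((fieldMeasure S₀.P j (SU N)).map (avOfPrint N S₀ j).avg).map (fun V : GaugeField S₀.P (j + 1) (SU N) => GaugeField.plaqHol V p) = (HaarData.haar : Measure (SU N)) := by
  haveI := HaarData.isProb (G := SU N)
  set ν := (fieldMeasure S₀.P j (SU N)).map (avOfPrint N S₀ j).avg with hν
  haveI : IsProbabilityMeasure ν := Measure.isProbabilityMeasure_map (measurable_avOfPrint N S₀ j).aemeasurable
  have hνinv : ∀ v : GaugeTransf S₀.P (j + 1) (SU N), ν.map (GaugeField.gaugeAct v) = ν := map_gaugeAct_imageLaw_avOfPrint N S₀ j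
  have hquadm : Measurable fun (V : GaugeField S₀.P (j + 1) (SU N)) (m : Fin 4) =>
      V ((![⟨p.src, p.μ⟩, ⟨p.src.shift p.μ, p.ν⟩, ⟨p.src.shift p.ν, p.μ⟩, ⟨p.src, p.ν⟩] : Fin 4 → PBond S₀.P (j + 1)) m) :=
    measurable_pi_lambda _ fun m => measurable_pi_apply _
  have hΦ4m : Measurable fun W : Fin 4 → SU N => W 0 * W 1 * (W 2)⁻¹ * (W 3)⁻¹ :=
    (((measurable_pi_apply 0).mul (measurable_pi_apply 1)).mul (measurable_pi_apply 2).inv).mul (measurable_pi_apply 3).inv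
  have hΦ4 : ∀ V : GaugeField S₀.P (j + 1) (SU N), (fun W : Fin 4 → SU N => W 0 * W 1 * (W 2)⁻¹ * (W 3)⁻¹)
      (fun m : Fin 4 => V ((![⟨p.src, p.μ⟩, ⟨p.src.shift p.μ, p.ν⟩, ⟨p.src.shift p.ν, p.μ⟩, ⟨p.src, p.ν⟩] : Fin 4 → PBond S₀.P (j + 1)) m)) = GaugeField.plaqHol V p :=
    fun V => rfl
  constructor
  · -- project the four variables to the holonomy
    intro hq
    have h1 := congrArg (fun μ : Measure (Fin 4 → SU N) => μ.map fun W : Fin 4 → SU N => W 0 * W 1 * (W 2)⁻¹ * (W 3)⁻¹) hq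
    rw [Measure.map_map hΦ4m hquadm, Measure.map_map hΦ4m hquadm] at h1
    have e : (fun W : Fin 4 → SU N => W 0 * W 1 * (W 2)⁻¹ * (W 3)⁻¹) ∘ (fun (V : GaugeField S₀.P (j + 1) (SU N)) (m : Fin 4) =>
        V ((![⟨p.src, p.μ⟩, ⟨p.src.shift p.μ, p.ν⟩, ⟨p.src.shift p.ν, p.μ⟩, ⟨p.src, p.ν⟩] : Fin 4 → PBond S₀.P (j + 1)) m)) =
        fun V => GaugeField.plaqHol V p := funext hΦ4
    rw [e] at h1
    rw [h1]
    exact map_plaqHol_fieldMeasure_eq_haar p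
  · -- both laws are `Haar³ ⊗ (holonomy law)` in the coordinates (tree, holonomy)
    intro hκ
    have hΨm : Measurable fun q : (Fin 3 → SU N) × SU N => (![q.1 0, q.1 1, q.1 2, q.2⁻¹ * q.1 0 * q.1 1 * (q.1 2)⁻¹] : Fin 4 → SU N) := by
      refine measurable_pi_lambda _ fun m => ?_
      have h0 : Measurable fun q : (Fin 3 → SU N) × SU N => q.1 0 := (measurable_pi_apply 0).comp measurable_fst
      have h1 : Measurable fun q : (Fin 3 → SU N) × SU N => q.1 1 := (measurable_pi_apply 1).comp measurable_fst
      have h2 : Measurable fun q : (Fin 3 → SU N) × SU N => q.1 2 := (measurable_pi_apply 2).comp measurable_fst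
      fin_cases m
      · exact h0
      · exact h1
      · exact h2
      · exact ((measurable_snd.inv.mul h0).mul h1).mul h2.inv
    have hTHm : Measurable fun V : GaugeField S₀.P (j + 1) (SU N) =>
        ((fun m : Fin 3 => V ((![⟨p.src, p.μ⟩, ⟨p.src.shift p.μ, p.ν⟩, ⟨p.src.shift p.ν, p.μ⟩] : Fin 3 → PBond S₀.P (j + 1)) m)), GaugeField.plaqHol V p) :=
      (measurable_pi_lambda _ fun m => measurable_pi_apply _).prodMk (measurable_plaqHol p)
    have hfac : (fun (V : GaugeField S₀.P (j + 1) (SU N)) (m : Fin 4) =>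
        V ((![⟨p.src, p.μ⟩, ⟨p.src.shift p.μ, p.ν⟩, ⟨p.src.shift p.ν, p.μ⟩, ⟨p.src, p.ν⟩] : Fin 4 → PBond S₀.P (j + 1)) m)) =
        (fun q : (Fin 3 → SU N) × SU N => (![q.1 0, q.1 1, q.1 2, q.2⁻¹ * q.1 0 * q.1 1 * (q.1 2)⁻¹] : Fin 4 → SU N)) ∘
          fun V : GaugeField S₀.P (j + 1) (SU N) =>
            ((fun m : Fin 3 => V ((![⟨p.src, p.μ⟩, ⟨p.src.shift p.μ, p.ν⟩, ⟨p.src.shift p.ν, p.μ⟩] : Fin 3 → PBond S₀.P (j + 1)) m)), GaugeField.plaqHol V p) :=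
      funext fun V => quad_eq_comp_treeHol p V
    have hν3 := map_plaquetteTree_prod_plaqHol h p ν inferInstance hνinv
    have hV3 := map_plaquetteTree_prod_plaqHol h p (fieldMeasure S₀.P (j + 1) (SU N)) inferInstance (map_gaugeAct_fieldMeasure (P := S₀.P) (k := j + 1) (G := SU N))
    rw [hfac, ← Measure.map_map hΨm hTHm, ← Measure.map_map hΨm hTHm, hν3, hV3, hκ, map_plaqHol_fieldMeasure_eq_haar p]

end Slot

end Summit.QuantumFields.YangMills.BalabanUVNodes.N08HaarCompatibilityPlaquetteTest

end
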